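import Literature.NumberTheory.LFunctions.DirichletLTruncationPackedLeafA
import Literature.NumberTheory.LFunctions.DirichletLTruncationPackedLeafD
import HarnessLib

/-!
# Packed truncation certificates — the drift bound of a leaf (analytic step)

The truncated sums `A_v(s, N) = Σ_{n ≤ N} v(n) n^{-s}` and the drift `D_v(s, N) = Σ_{N' ≤ N} max(0, −A_v(s, N'))/N'` of
`LTruncation.cell_bound`, the per-cell invariant of the packed certificate, and the analytic half of the D-part of a leaf:
if the running value `pref` under-estimates `2^P A(s, n₀−1)` and `wlo ≤ 2^P x^{-s} ≤ c0h` on the leaf, the running values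
`p_t` of `leafCell` under-estimate `2^P A(s, n₀+t)`, so `Σ_t max(0, −p_t)/n₀` dominates `2^P (D(s, n₀+L−1) − D(s, n₀−1))`.
[cite: Chua2005RealZeros, §2.2 ALGO 1]
-/

namespace Literature.NumberTheory.LFunctions

namespace LTruncationPacked

open Finset FeketePolyaKernel LTruncationCert Literature.Analysis.Convolution

/-- `A_v(s, N) = Σ_{n=1}^{N} v(n) n^{-s}` (shape of `LTruncation.cell_bound`). [cite: Chua2005RealZeros, §2.2 ALGO 1] -/
noncomputable def Asum (v : ℕ → ℤ) (s : ℝ) (N : ℕ) : ℝ :=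
  ∑ n ∈ range N, (v (n + 1) : ℝ) * ((n + 1 : ℕ) : ℝ) ^ (-s)

/-- `D_v(s, N) = Σ_{N'=1}^{N} max(0, −A_v(s, N'))/N'`. [cite: Chua2005RealZeros, §2.2 ALGO 1] -/
noncomputable def Dsum (v : ℕ → ℤ) (s : ℝ) (N : ℕ) : ℝ :=
  ∑ i ∈ range N, max 0 (-(Asum v s (i + 1))) / ((i + 1 : ℕ) : ℝ)

/-- The per-cell invariant after the terms `n < n₀`: `pref ≤ 2^P A(s, n₀−1)` and `2^P D(s, n₀−1) ≤ d`, `s = i/E`.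
[cite: Chua2005RealZeros, §2.2 ALGO 1] -/
def CellInv (P E : ℕ) (v : ℕ → ℤ) (n₀ : ℕ) (iw : ℕ × ℕ) (ad : ℤ × ℕ) : Prop :=
  (ad.1 : ℝ) ≤ (2 : ℝ) ^ P * Asum v ((iw.1 : ℝ) / E) (n₀ - 1) ∧
    (2 : ℝ) ^ P * Dsum v ((iw.1 : ℝ) / E) (n₀ - 1) ≤ (ad.2 : ℝ)

section DBound

variable {v : ℕ → ℤ} {s : ℝ}

/-- Splitting `A` at `n₀ − 1`: `A(n₀ − 1 + (t+1)) = A(n₀ − 1) + Σ_{j ≤ t} v(n₀+j)(n₀+j)^{-s}` (`n₀ ≥ 1`). [folklore] -/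
private theorem Asum_split {n₀ : ℕ} (hn₀ : 1 ≤ n₀) (t : ℕ) :
    Asum v s (n₀ + t) = Asum v s (n₀ - 1) +
      ∑ j ∈ range (t + 1), (v (n₀ + j) : ℝ) * ((n₀ + j : ℕ) : ℝ) ^ (-s) := by
  rw [Asum, Asum, show n₀ + t = (n₀ - 1) + (t + 1) by omega, Finset.sum_range_add]
  congr 1
  refine Finset.sum_congr rfl fun j _ => ?_
  rw [show n₀ - 1 + j + 1 = n₀ + j by omega]

/-- The running values under-estimate the partial sums: `p_t ≤ 2^P A(s, n₀ + t)`. [cite: Chua2005RealZeros, §2.2 ALGO 1] -/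
theorem prefRun_le_Asum {P n₀ L wlo c0h : ℕ} {pref : ℤ} (hv : ∀ n, v n = 0 ∨ v n = 1 ∨ v n = -1) (hn₀ : 1 ≤ n₀)
    (hpref : (pref : ℝ) ≤ (2 : ℝ) ^ P * Asum v s (n₀ - 1))
    (hwlo : ∀ t < L, (wlo : ℝ) ≤ (2 : ℝ) ^ P * ((n₀ + t : ℕ) : ℝ) ^ (-s))
    (hc0h : ∀ t < L, (2 : ℝ) ^ P * ((n₀ + t : ℕ) : ℝ) ^ (-s) ≤ c0h) {t : ℕ} (ht : t < L) :
    ((prefRun pref wlo c0h (sgnP v n₀) (sgnM v n₀) t : ℤ) : ℝ) ≤ (2 : ℝ) ^ P * Asum v s (n₀ + t) := by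
  rw [Asum_split hn₀, mul_add, prefRun, psumF, psumF]
  simp only [Int.cast_add, Int.cast_sub, Nat.cast_mul, Nat.cast_sum, Int.cast_sum, Int.cast_mul, Int.cast_natCast]
  rw [Finset.mul_sum, Finset.mul_sum, Finset.mul_sum]
  have hterm : ∀ j ∈ range (t + 1), (wlo : ℝ) * (sgnP v n₀ j : ℝ) - (c0h : ℝ) * (sgnM v n₀ j : ℝ) ≤
      (2 : ℝ) ^ P * ((v (n₀ + j) : ℝ) * ((n₀ + j : ℕ) : ℝ) ^ (-s)) := by
    intro j hj
    have hjL : j < L := by have := Finset.mem_range.1 hj; omega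
    rcases hv (n₀ + j) with h0 | h1 | h2
    · simp [sgnP, sgnM, ind, h0]
    · have := hwlo j hjL
      simp only [sgnP, sgnM, ind, h1, if_true, show (1 : ℤ) ≠ -1 by decide, if_false, Nat.cast_one, Nat.cast_zero,
        mul_one, mul_zero, sub_zero, Int.cast_one, one_mul]
      exact this
    · have := hc0h j hjL
      simp only [sgnP, sgnM, ind, h2, show (-1 : ℤ) ≠ 1 by decide, if_false, if_true, Nat.cast_one, Nat.cast_zero,
        mul_one, mul_zero, zero_sub, Int.cast_neg, Int.cast_one]
      linarith
  have hsum := Finset.sum_le_sum hterm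
  rw [Finset.sum_sub_distrib] at hsum
  linarith

/-- `((−z).toNat : ℝ) = max 0 (−z)`. [folklore] -/
private theorem cast_toNat_neg (z : ℤ) : (((-z).toNat : ℕ) : ℝ) = max 0 (-(z : ℝ)) := by
  rcases le_or_gt 0 (-z) with h | h
  · have : (((-z).toNat : ℕ) : ℤ) = -z := Int.toNat_of_nonneg h
    have h' : (0 : ℝ) ≤ -(z : ℝ) := by exact_mod_cast h
    rw [max_eq_right h']; exact_mod_cast this
  · have : (-z).toNat = 0 := by rw [Int.toNat_eq_zero]; omega
    have h' : -(z : ℝ) < 0 := by exact_mod_cast h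
    rw [this, max_eq_left h'.le]; simp

/-- **The drift bound of a leaf.** [cite: Chua2005RealZeros, §2.2 ALGO 1] -/
theorem leaf_D_bound {P n₀ L wlo c0h : ℕ} {pref : ℤ} (hv : ∀ n, v n = 0 ∨ v n = 1 ∨ v n = -1) (hn₀ : 1 ≤ n₀)
    (hpref : (pref : ℝ) ≤ (2 : ℝ) ^ P * Asum v s (n₀ - 1))
    (hwlo : ∀ t < L, (wlo : ℝ) ≤ (2 : ℝ) ^ P * ((n₀ + t : ℕ) : ℝ) ^ (-s))
    (hc0h : ∀ t < L, (2 : ℝ) ^ P * ((n₀ + t : ℕ) : ℝ) ^ (-s) ≤ c0h) :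
    (2 : ℝ) ^ P * (Dsum v s (n₀ + L - 1) - Dsum v s (n₀ - 1)) ≤
      (∑ t ∈ range L, (((-(prefRun pref wlo c0h (sgnP v n₀) (sgnM v n₀) t)).toNat : ℕ) : ℝ)) / n₀ := by
  have hn₀0 : (0 : ℝ) < n₀ := by exact_mod_cast hn₀
  have h2P : (0 : ℝ) < 2 ^ P := by positivity
  -- the drift increment as a sum over the leaf
  have hsplit : Dsum v s (n₀ + L - 1) - Dsum v s (n₀ - 1) =
      ∑ t ∈ range L, max 0 (-(Asum v s (n₀ + t))) / ((n₀ + t : ℕ) : ℝ) := by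
    rw [Dsum, Dsum, show n₀ + L - 1 = (n₀ - 1) + L by omega, Finset.sum_range_add, add_sub_cancel_left]
    refine Finset.sum_congr rfl fun t _ => ?_
    rw [show n₀ - 1 + t + 1 = n₀ + t by omega]
  rw [hsplit, Finset.mul_sum, le_div_iff₀ hn₀0, Finset.sum_mul]
  refine Finset.sum_le_sum fun t ht => ?_
  have htL : t < L := Finset.mem_range.1 ht
  have hp := prefRun_le_Asum hv hn₀ hpref hwlo hc0h htL
  set p : ℤ := prefRun pref wlo c0h (sgnP v n₀) (sgnM v n₀) t
  have hnt : (0 : ℝ) < ((n₀ + t : ℕ) : ℝ) := by exact_mod_cast (show 0 < n₀ + t by omega)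
  have hn0nt : (n₀ : ℝ) ≤ ((n₀ + t : ℕ) : ℝ) := by exact_mod_cast (Nat.le_add_right _ _)
  rw [cast_toNat_neg]
  -- `2^P max(0, −A) ≤ max(0, −p)` and `n₀/(n₀+t) ≤ 1`
  have hmax : (2 : ℝ) ^ P * max 0 (-(Asum v s (n₀ + t))) ≤ max 0 (-(p : ℝ)) := by
    rcases le_or_gt 0 (Asum v s (n₀ + t)) with hA | hA
    · rw [max_eq_left (by linarith)]; simp
    · rw [max_eq_right (by linarith)]
      calc (2 : ℝ) ^ P * -Asum v s (n₀ + t) ≤ -(p : ℝ) := by linarith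
        _ ≤ max 0 (-(p : ℝ)) := le_max_right _ _
  have hm0 : 0 ≤ max 0 (-(p : ℝ)) := le_max_left _ _
  have hA0 : 0 ≤ max 0 (-(Asum v s (n₀ + t))) := le_max_left _ _
  calc (2 : ℝ) ^ P * (max 0 (-(Asum v s (n₀ + t))) / ((n₀ + t : ℕ) : ℝ)) * n₀
      = ((2 : ℝ) ^ P * max 0 (-(Asum v s (n₀ + t)))) * ((n₀ : ℝ) / ((n₀ + t : ℕ) : ℝ)) := by
        field_simp
    _ ≤ max 0 (-(p : ℝ)) * 1 := by
        refine mul_le_mul hmax ((div_le_one hnt).2 hn0nt) (by positivity) hm0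
    _ = max 0 (-(p : ℝ)) := mul_one _

end DBound

end LTruncationPacked

end Literature.NumberTheory.LFunctions
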